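import Summits.BirchSwinnertonDyer.BirchSwinnertonDyer.Theorems.ThetaPartnerAtTwoSignedControlAtTwoPlusKimOfPrint
import Literature.NumberTheory.EllipticCurves.IwasawaSelmerDualUniquenessProofs
import Literature.NumberTheory.EllipticCurves.IwasawaSelmerTorsionProofs
import Literature.NumberTheory.EllipticCurves.BSDSelmerCMPConverseHeegnerDescentProofs
import Literature.NumberTheory.EllipticCurves.SelmerCorankControlRatProofs
import Literature.NumberTheory.EllipticCurves.BSDConductorProofs
import Mathlib.Algebra.Module.CharacterModule
import HarnessLib

/-!
# K4 `SignedControlAtTwo` (stmt-BirchSwinnertonDyer-20309): the weak-Leopoldt input `rank_Λ Y = 1` of the COINV door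
# is FREE under `Sel_{p^∞}(E/K)` finite — from the corank count (Greenberg pp. 119–120) and «`X(E/K_∞)` is not
# `Λ`-torsion» (Greenberg Thm. 1.7 at a supersingular prime)

Route `ThetaPartnerAtTwo` (TP2; crux shared with `ResidualThetaTransportAtTwo`), crux K4 `SignedControlAtTwo`, line
`eulerchar` v7 (lead `prover-bsd-wall-tp2-p3` g3). The door `SignedEC.signedEndCoinvariants_subsingleton_two_of_print`
(seat w2) consumes the named fact `Greenberg1999.h1SigmaInfty_rank_eq_one` (weak Leopoldt over `ℚ_∞`, Kato Astérisque 295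
Thm. 12.4) ONLY as «`Module.rank Λ Y = 1`» for a finitely generated Pontryagin-dual datum `Y` of
`H = H¹(K_Σ/K_∞, E[p^∞]) = unramifiedOutside (ker κ) E[p^∞] p Σ₀`, and feeds it (with the corank count
`coinvariantsRank p Y ≤ 1`) to `IwasawaAlgebra.finite_invariants_of_rank_eq_one_of_coinvariantsRank_le_one`.

THIS FILE proves that the UPPER half of that rank statement is automatic and the LOWER half is Greenberg's Thm. 1.7:

* §1 (commutative algebra) `finrank_le_coinvariantsRank`: `rank_Λ Y ≤ rank_{ℤ_p} Y/TY` for every finitely generated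
  `Λ = ℤ_p⟦T⟧`-module (`Y ↠ Y/Y_tors` torsion-free, `ℓ_{(T)}((Y/Y_tors)_Γ) = rank_Λ Y`); hence
  `rank_eq_one_of_not_isTorsion_of_coinvariantsRank_le_one`.
* §2 `selmerInfty_le_unramifiedOutside`: `Sel_{p^∞}(E/K_∞) ⊆ H` (Kummer condition at a good `v ∤ p` ⇒ unramified).
* §3 `exists_linearMap_selmerDualData_surjective`: for EVERY dual datum `(Y, dY)` of `H` (the two identities `T ↦ conj_γ − 1`,
  constants through `ℤ_p → ℤ/p^k`), restriction of characters to `Sel_∞` is a SURJECTIVE `Λ`-linear map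
  `Y ↠ X(E/K_∞)` onto the canonical Iwasawa module (`W.selmerDualData κ hγ`): `Λ`-linearity because both actions read
  through the characters are the canonical finite sums (induction on the nilpotence index of `conj_γ − 1`, as in
  `SelmerDualData.toDual_smul`); surjectivity by divisibility of `ℚ/ℤ` (`CharacterModule.dual_surjective_of_injective`).
  Hence `not_isTorsion_of_not_isTorsion_selmerDualData`: `X(E/K_∞)` not `Λ`-torsion ⇒ `Y` not `Λ`-torsion.
* §4 `h1SigmaInfty_rank_eq_one_of_zpCorank_le_one_of_not_isTorsion` (any number field, any `ℤ_p`-extension with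
  topological generator): `corank_{ℤ_p} H¹(K_Σ/K, E[p^∞]) ≤ 1` ∧ `X(E/K_∞)` not torsion ⇒ `rank_Λ Y = 1`; and over `ℚ`
  at a good supersingular `p` (`GoodSS W p`): `h1SigmaInfty_rank_eq_one_of_corank_of_notTorsion` — the door's `hrank`
  from `Greenberg1999.h1Sigma_zpCorank_le_degree ℚ` + `Finite (Sel_{p^∞}(E/ℚ))` + the named fact
  `SelmerDualData.not_isTorsion_of_supersingular` (Greenberg LNM 1716 Thm. 1.7; tree split (I1)+(I2),
  `not_isTorsion_of_supersingular_holds_of`) INSTEAD of Kato's Thm. 12.4.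

HONEST FRAMING: THEOREMS ONLY (no definition, no named fact, no `sorry`); closes no item by itself; the K4 residue after
this file and its sibling `…OfPubThreeNotTorsion` is {Cassels = Prop. 4.13, Prop. 4.12, pp. 119–120, Thm. 1.7} — weak
Leopoldt / Kato 12.4 is not needed for K4. BSD is not proved by any of this.

References: [GreenbergLNM1716] §1 Thm. 1.7 (pp. 61–62), §4 p. 119, Prop. 4.12; [Kato2004Asterisque] Thm. 12.4 (the fact made
idle); [Washington1997] §13.2.
-/

set_option autoImplicit false
-- the Theorems namespace of this sub repeats the summit name by design (D-0017 nested layout)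
set_option linter.dupNamespace false

noncomputable section

open scoped Classical NumberField

open NumberField IsDedekindDomain

universe u

namespace Summit.BirchSwinnertonDyer.BirchSwinnertonDyer.Theorems.SignedEC.H1SigmaRank

open Literature.NumberTheory.EllipticCurves Literature.NumberTheory.GaloisRepresentations
  WeierstrassCurve ZpExtension Literature.NumberTheory.EllipticCurves.IwasawaDual
  Literature.NumberTheory.EllipticCurves.IwasawaAlgebra Literature.NumberTheory.EllipticCurves.GreenbergVatsal2000

/-! ## §1 Commutative algebra: `rank_Λ Y ≤ rank_{ℤ_p} Y/TY` -/

section Algebra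

variable (p : ℕ) [Fact p.Prime]

/-- **`rank_Λ Y ≤ rank_{ℤ_p} Y/TY`** for a finitely generated `Λ = ℤ_p⟦T⟧`-module `Y`: with `Q = Y/Y_tors`
(torsion-free, same `Λ`-rank by rank–nullity over the domain `Λ`), `ℓ_{(T)}(Q/TQ) = rank_Λ Q`
(`lengthAt_coinvariants_eq_finrank_of_isTorsionFree`) and `Q/TQ` is a quotient of `Y/TY`
(`lengthAt_coinvariants_le_of_finite_coker`, `ℓ_{(T)}(Y/TY) = coinvariantsRank`). [cite: Washington1997, §13.2] -/
theorem finrank_le_coinvariantsRank {Y : Type u} [AddCommGroup Y] [Module (IwasawaAlgebra p) Y]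
    [Module.Finite (IwasawaAlgebra p) Y] :
    Module.finrank (IwasawaAlgebra p) Y ≤ coinvariantsRank p Y := by
  set Yt := Submodule.torsion (IwasawaAlgebra p) Y with hYt
  have htors : Module.IsTorsion (IwasawaAlgebra p) Yt := Submodule.torsion_isTorsion
  -- `rank (Y/Y_tors) = rank Y`
  have hrk : Module.finrank (IwasawaAlgebra p) (Y ⧸ Yt) = Module.finrank (IwasawaAlgebra p) Y := by
    have hsum := rank_quotient_add_rank_of_isDomain Yt
    rw [rank_eq_zero_iff_isTorsion.mpr htors, add_zero] at hsum
    rw [Module.finrank, Module.finrank, hsum]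
  -- `ℓ((Y/Y_tors)_Γ) = rank`
  have hQ : Module.lengthAt (IwasawaAlgebra p) (coinvariants p (Y ⧸ Yt)) (primeT p) =
      Module.finrank (IwasawaAlgebra p) (Y ⧸ Yt) :=
    lengthAt_coinvariants_eq_finrank_of_isTorsionFree p
  -- `(Y/Y_tors)_Γ` is a quotient of `Y_Γ`
  have hcok : Finite ((Y ⧸ Yt) ⧸ LinearMap.range Yt.mkQ) := by
    rw [Submodule.range_mkQ]
    infer_instance
  have hle := lengthAt_coinvariants_le_of_finite_coker p Yt.mkQ hcok
  rw [lengthAt_coinvariants_eq_coinvariantsRank p Y, hQ, hrk] at hle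
  exact_mod_cast hle

/-- **`Y` not `Λ`-torsion ∧ `rank_{ℤ_p} Y/TY ≤ 1` ⇒ `rank_Λ Y = 1`** (finitely generated `Y`): `rank_Λ Y ≥ 1` since a
finitely generated module of rank `0` over the domain `Λ` is torsion, `rank_Λ Y ≤ rank_{ℤ_p} Y/TY ≤ 1` by
`finrank_le_coinvariantsRank`. [cite: Washington1997, §13.2] -/
theorem rank_eq_one_of_not_isTorsion_of_coinvariantsRank_le_one {Y : Type u} [AddCommGroup Y]
    [Module (IwasawaAlgebra p) Y] [Module.Finite (IwasawaAlgebra p) Y]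
    (hnt : ¬ Module.IsTorsion (IwasawaAlgebra p) Y) (hco : coinvariantsRank p Y ≤ 1) :
    Module.rank (IwasawaAlgebra p) Y = 1 := by
  have h1 : Module.finrank (IwasawaAlgebra p) Y ≤ 1 := (finrank_le_coinvariantsRank p).trans hco
  have h0 : Module.finrank (IwasawaAlgebra p) Y ≠ 0 := fun h ↦
    hnt (Module.finrank_eq_zero_iff_isTorsion.mp h)
  have hfr : Module.finrank (IwasawaAlgebra p) Y = 1 := by omega
  have hlt := Module.rank_lt_aleph0 (IwasawaAlgebra p) Y
  rw [← Cardinal.cast_toNat_of_lt_aleph0 hlt]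
  change ((Module.finrank (IwasawaAlgebra p) Y : ℕ) : Cardinal) = 1
  rw [hfr, Nat.cast_one]

end Algebra

/-! ## §2 `Sel_{p^∞}(E/K_∞) ⊆ H¹(K_Σ/K_∞, E[p^∞])` -/

section Selmer

variable {K : Type u} [Field K] [NumberField K] (W : WeierstrassCurve K) [W.IsElliptic] {p : ℕ} [Fact p.Prime]
  (κ : ZpExtension K p)

/-- **`Sel_{p^∞}(E/K_∞) ⊆ H¹(K_Σ/K_∞, E[p^∞])`** for `Σ₀` with good reduction off `Σ₀ ∪ {v ∣ p}`: the classical Kummer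
condition at a good `v ∤ p` is unramified (Silverman AEC X.4.4 = tree `GreenbergVatsalSelmerLink.localKerOver_le_unramKer`,
at every conjugate). [cite: SilvermanAEC2009, Cor. X.4.4] [cite: GreenbergVatsal2000, §2 pp. 16–17] -/
theorem selmerInfty_le_unramifiedOutside (S₀ : Set (HeightOneSpectrum (𝓞 K)))
    (hgood : ∀ v : HeightOneSpectrum (𝓞 K), v ∉ S₀ → ((p : ℕ) : 𝓞 K) ∉ v.asIdeal → W.HasGoodReductionAt v) :
    W.selmerInfty κ ≤ unramifiedOutside κ.kerSubgroup (W.geomPrimaryTorsion p) p S₀ := by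
  intro s hs
  rw [mem_unramifiedOutside_iff]
  intro v hv hpv σ
  have h := ((W.mem_selmerGroupOver_iff p κ.kerSubgroup _).mp hs).1 v σ
  exact Summit.BirchSwinnertonDyer.Rank1Residual.X2.GreenbergVatsalSelmerLink.localKerOver_le_unramKer (W := W)
    (p := p) (H := κ.kerSubgroup) (hgood v hv hpv) hpv h

end Selmer

/-! ## §3 Every dual datum of `H¹(K_Σ/K_∞, E[p^∞])` maps `Λ`-linearly ONTO `X(E/K_∞)` -/

section Quotient

variable {K : Type u} [Field K] [NumberField K] (W : WeierstrassCurve K) {p : ℕ} [Fact p.Prime]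
  (κ : ZpExtension K p) {γ : Field.absoluteGaloisGroup K}

/-- Induction carrier (as in `SelmerDualData.toDual_smul_apply_of_pow_apply_eq_zero`): on Selmer classes `s` killed by
`(conj_γ − 1)^N`, the `Λ`-action of ANY dual datum `(Y, dY)` of `H ⊇ Sel_∞`, read through the characters `dY y`
restricted to `Sel_∞`, is the canonical finite sum `IsLocNil.smulFun` (peel off the constant term `f = T·g + C(a₀)`).
[cite: GreenbergLNM1716, §1 (after Conj. 1.3)] [cite: Washington1997, §13.2] -/
theorem dY_smul_apply_of_pow_apply_eq_zero (hγ : κ.IsTopGenerator γ)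
    {H : AddSubgroup (W.subgroupH1 p κ.kerSubgroup)} (hle : W.selmerInfty κ ≤ H)
    (hconj : ∀ c ∈ H, W.conjH1 p κ.kerSubgroup γ c ∈ H)
    {Y : Type*} [AddCommGroup Y] [Module (IwasawaAlgebra p) Y]
    (dY : Y →+ (H →+ AddCircle (1 : ℚ)))
    (hT : ∀ (y : Y) (x : H), dY ((PowerSeries.X : IwasawaAlgebra p) • y) x =
        dY y ⟨W.conjH1 p κ.kerSubgroup γ x, hconj _ x.2⟩ - dY y x)
    (hC : ∀ (a : ℤ_[p]) (y : Y) (x : H) (k : ℕ), (p ^ k) • x = 0 →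
      dY (PowerSeries.C a • y) x = (PadicInt.toZModPow k a).val • dY y x) (N : ℕ) :
    ∀ (s : W.selmerInfty κ), ((W.conjSelmerInfty κ γ - 1) ^ N) s = 0 →
      ∀ (f : IwasawaAlgebra p) (y : Y),
        dY (f • y) (AddSubgroup.inclusion hle s) =
          (W.isLocNil_conjSelmerInfty_sub_one κ hγ).smulFun f ((dY y).comp (AddSubgroup.inclusion hle)) s := by
  set h := W.isLocNil_conjSelmerInfty_sub_one κ hγ
  set ψ : AddMonoid.End (W.selmerInfty κ) := W.conjSelmerInfty κ γ - 1 with hψ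
  induction N with
  | zero =>
    intro s hs f y
    rw [pow_zero, AddMonoid.End.one_apply] at hs
    rw [hs, map_zero, map_zero, map_zero]
  | succ N ih =>
    intro s hs f y
    obtain ⟨k, hk⟩ := h.torsion s
    have hk' : (p ^ k) • AddSubgroup.inclusion hle s = 0 := by
      rw [← map_nsmul, hk, map_zero]
    have hψs : (ψ ^ N) (ψ s) = 0 := by
      rwa [pow_succ, AddMonoid.End.coe_mul, Function.comp_apply] at hs
    -- `ψ s = conj_γ s - s`, read in `H`
    have hval : ((AddSubgroup.inclusion hle (ψ s) : H) : W.subgroupH1 p κ.kerSubgroup) =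
        W.conjH1 p κ.kerSubgroup γ ((AddSubgroup.inclusion hle s : H) : W.subgroupH1 p κ.kerSubgroup) -
          ((AddSubgroup.inclusion hle s : H) : W.subgroupH1 p κ.kerSubgroup) := by
      rw [AddSubgroup.coe_inclusion, AddSubgroup.coe_inclusion, hψ, IwasawaDual.End_sub_apply,
        AddMonoid.End.one_apply, AddSubgroupClass.coe_sub, W.coe_conjSelmerInfty_apply]
    have hincl : AddSubgroup.inclusion hle (ψ s) =
        ⟨W.conjH1 p κ.kerSubgroup γ (AddSubgroup.inclusion hle s), hconj _ (AddSubgroup.inclusion hle s).2⟩ -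
          AddSubgroup.inclusion hle s :=
      Subtype.ext (by rw [hval, AddSubgroupClass.coe_sub])
    have hψeval : ∀ y' : Y, dY y' (AddSubgroup.inclusion hle (ψ s)) =
        dY y' ⟨W.conjH1 p κ.kerSubgroup γ (AddSubgroup.inclusion hle s), hconj _ (AddSubgroup.inclusion hle s).2⟩ -
          dY y' (AddSubgroup.inclusion hle s) := fun y' ↦ by
      rw [hincl, map_sub]
    -- peel off the constant term
    set g : IwasawaAlgebra p := PowerSeries.mk fun n ↦ PowerSeries.coeff (n + 1) f
    set a : ℤ_[p] := PowerSeries.constantCoeff f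
    have hf : f = PowerSeries.X * g + PowerSeries.C a := PowerSeries.eq_X_mul_shift_add_const f
    have lhs : dY (f • y) (AddSubgroup.inclusion hle s) =
        dY (g • y) (AddSubgroup.inclusion hle (ψ s)) +
          (PadicInt.toZModPow k a).val • dY y (AddSubgroup.inclusion hle s) := by
      conv_lhs => rw [hf]
      rw [add_smul, mul_smul, map_add, AddMonoidHom.add_apply, hT, hC a y _ k hk', hψeval]
    have rhs : h.smulFun f ((dY y).comp (AddSubgroup.inclusion hle)) s =
        h.smulFun g ((dY y).comp (AddSubgroup.inclusion hle)) (ψ s) +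
          (PadicInt.toZModPow k a).val • dY y (AddSubgroup.inclusion hle s) := by
      conv_lhs => rw [hf]
      rw [h.smulFun_add_left, h.smulFun_mul_left, AddMonoidHom.add_apply, h.smulFun_X_apply,
        h.smulFun_C_apply a _ hk, AddMonoidHom.comp_apply]
    rw [lhs, rhs, ih (ψ s) hψs g y]

/-- **Restriction of characters `Y → X(E/K_∞)`, `y ↦ (dY y)|_{Sel_∞}`, is a SURJECTIVE `Λ`-linear map** onto the canonical
Iwasawa module `X(E/K_∞) = Hom(Sel_{p^∞}(E/K_∞), ℚ/ℤ)` (`W.selmerDualData κ hγ`), for every Pontryagin-dual datum `(Y, dY)`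
of an additive subgroup `H ⊇ Sel_∞` of `H¹(K_∞, E[p^∞])` stable under `conj_γ` (bijective `dY`, the two identities).
`Λ`-linear by `dY_smul_apply_of_pow_apply_eq_zero` (every Selmer class is killed by a power of `conj_γ − 1`,
`isLocNil_conjSelmerInfty_sub_one`); onto because `ℚ/ℤ` is divisible (`CharacterModule.dual_surjective_of_injective`)
and `dY` is onto. [cite: GreenbergLNM1716, §1 (after Conj. 1.3)] -/
theorem exists_linearMap_selmerDualData_surjective (hγ : κ.IsTopGenerator γ)
    {H : AddSubgroup (W.subgroupH1 p κ.kerSubgroup)} (hle : W.selmerInfty κ ≤ H)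
    (hconj : ∀ c ∈ H, W.conjH1 p κ.kerSubgroup γ c ∈ H)
    {Y : Type*} [AddCommGroup Y] [Module (IwasawaAlgebra p) Y]
    (dY : Y →+ (H →+ AddCircle (1 : ℚ))) (hbij : Function.Bijective dY)
    (hT : ∀ (y : Y) (x : H), dY ((PowerSeries.X : IwasawaAlgebra p) • y) x =
        dY y ⟨W.conjH1 p κ.kerSubgroup γ x, hconj _ x.2⟩ - dY y x)
    (hC : ∀ (a : ℤ_[p]) (y : Y) (x : H) (k : ℕ), (p ^ k) • x = 0 →
      dY (PowerSeries.C a • y) x = (PadicInt.toZModPow k a).val • dY y x) :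
    ∃ φ : Y →ₗ[IwasawaAlgebra p] (W.selmerDualData κ hγ).X,
      Function.Surjective φ ∧ ∀ y, (W.selmerDualData κ hγ).toDual (φ y) = (dY y).comp (AddSubgroup.inclusion hle) := by
  set h := W.isLocNil_conjSelmerInfty_sub_one κ hγ
  let φ : Y →ₗ[IwasawaAlgebra p] (W.selmerDualData κ hγ).X :=
    { toFun := fun y ↦ (dY y).comp (AddSubgroup.inclusion hle)
      map_add' := fun y y' ↦ by
        change (dY (y + y')).comp (AddSubgroup.inclusion hle) =
          (dY y).comp (AddSubgroup.inclusion hle) + (dY y').comp (AddSubgroup.inclusion hle)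
        rw [map_add, AddMonoidHom.add_comp]
      map_smul' := fun f y ↦ by
        refine AddMonoidHom.ext fun s ↦ ?_
        obtain ⟨N, hN⟩ := h.nil s
        rw [AddMonoidHom.comp_apply, RingHom.id_apply]
        exact dY_smul_apply_of_pow_apply_eq_zero W κ hγ hle hconj dY hT hC N s hN f y }
  refine ⟨φ, fun x ↦ ?_, fun y ↦ rfl⟩
  -- extend the character `x` of `Sel_∞` to `H` (divisibility of `ℚ/ℤ`), then pull back along `dY`
  have hinj : Function.Injective ((AddSubgroup.inclusion hle).toIntLinearMap) := AddSubgroup.inclusion_injective hle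
  obtain ⟨χ, hχ⟩ := CharacterModule.dual_surjective_of_injective _ hinj x
  obtain ⟨y, hy⟩ := hbij.2 χ
  refine ⟨y, ?_⟩
  change (dY y).comp (AddSubgroup.inclusion hle) = x
  rw [hy, ← hχ]
  rfl

/-- **`X(E/K_∞)` not `Λ`-torsion ⇒ `Y` not `Λ`-torsion**, for every dual datum `Y` of `H ⊇ Sel_∞` as above (a quotient of a
torsion module is torsion, `IwasawaAlgebra.isTorsion_of_surjective`). [cite: GreenbergLNM1716, §1 Thm. 1.7] -/
theorem not_isTorsion_of_not_isTorsion_selmerDualData (hγ : κ.IsTopGenerator γ)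
    {H : AddSubgroup (W.subgroupH1 p κ.kerSubgroup)} (hle : W.selmerInfty κ ≤ H)
    (hconj : ∀ c ∈ H, W.conjH1 p κ.kerSubgroup γ c ∈ H)
    {Y : Type u} [AddCommGroup Y] [Module (IwasawaAlgebra p) Y]
    (dY : Y →+ (H →+ AddCircle (1 : ℚ))) (hbij : Function.Bijective dY)
    (hT : ∀ (y : Y) (x : H), dY ((PowerSeries.X : IwasawaAlgebra p) • y) x =
        dY y ⟨W.conjH1 p κ.kerSubgroup γ x, hconj _ x.2⟩ - dY y x)
    (hC : ∀ (a : ℤ_[p]) (y : Y) (x : H) (k : ℕ), (p ^ k) • x = 0 →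
      dY (PowerSeries.C a • y) x = (PadicInt.toZModPow k a).val • dY y x)
    (hNT : ¬ (W.selmerDualData κ hγ).IsTorsion) :
    ¬ Module.IsTorsion (IwasawaAlgebra p) Y := by
  intro hY
  obtain ⟨φ, hφ, -⟩ := exists_linearMap_selmerDualData_surjective W κ hγ hle hconj dY hbij hT hC
  exact hNT (IwasawaAlgebra.isTorsion_of_surjective φ hφ hY)

end Quotient

/-! ## §4 `rank_Λ Y = 1` for the dual of `H¹(K_Σ/K_∞, E[p^∞])` from the corank count and Thm. 1.7 -/

section Rank

variable {K : Type u} [Field K] [NumberField K] (W : WeierstrassCurve K) [W.IsElliptic] {p : ℕ} [Fact p.Prime]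
  (κ : ZpExtension K p) {γ : Field.absoluteGaloisGroup K}

/-- **`rank_Λ Y = 1` for every finitely generated dual datum `Y` of `H¹(K_Σ/K_∞, E[p^∞])`, from
`corank_{ℤ_p} H¹(K_Σ/K, E[p^∞]) ≤ 1` and «`X(E/K_∞)` not `Λ`-torsion»** (any number field `K`, any `ℤ_p`-extension `κ`
with topological generator `γ`, `Σ₀` finite with good reduction off `Σ₀ ∪ {v ∣ p}`): `rank_{ℤ_p} Y/TY = corank_{ℤ_p}
H¹(K_Σ/K, E[p^∞])` (`SSFlatEC.coinvariantsRank_eq_zpCorank_unramifiedOutside_top`), §1 and §3.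
[cite: GreenbergLNM1716, §4 p. 119; §1 Thm. 1.7] -/
theorem h1SigmaInfty_rank_eq_one_of_zpCorank_le_one_of_not_isTorsion (hγ : κ.IsTopGenerator γ)
    {S₀ : Set (HeightOneSpectrum (𝓞 K))} (hS₀ : S₀.Finite)
    (hgood : ∀ v : HeightOneSpectrum (𝓞 K), v ∉ S₀ → ((p : ℕ) : 𝓞 K) ∉ v.asIdeal → W.HasGoodReductionAt v)
    {Y : Type u} [AddCommGroup Y] [Module (IwasawaAlgebra p) Y] [Module.Finite (IwasawaAlgebra p) Y]
    (dY : Y →+ (unramifiedOutside κ.kerSubgroup (W.geomPrimaryTorsion p) p S₀ →+ AddCircle (1 : ℚ)))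
    (hbij : Function.Bijective dY)
    (hT : ∀ (y : Y) (x : unramifiedOutside κ.kerSubgroup (W.geomPrimaryTorsion p) p S₀),
      dY ((PowerSeries.X : IwasawaAlgebra p) • y) x =
        dY y ⟨W.conjH1 p κ.kerSubgroup γ x,
          conjH1_mem_unramifiedOutside κ.kerSubgroup (W.geomPrimaryTorsion p) p _ γ x.2⟩ - dY y x)
    (hC : ∀ (a : ℤ_[p]) (y : Y) (x : unramifiedOutside κ.kerSubgroup (W.geomPrimaryTorsion p) p S₀) (k : ℕ),
      (p ^ k) • x = 0 → dY (PowerSeries.C a • y) x = (PadicInt.toZModPow k a).val • dY y x)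
    (hco : zpCorank ↥(unramifiedOutside (⊤ : Subgroup (Field.absoluteGaloisGroup K)) (W.geomPrimaryTorsion p) p S₀) p ≤ 1)
    (hNT : ¬ (W.selmerDualData κ hγ).IsTorsion) :
    Module.rank (IwasawaAlgebra p) Y = 1 := by
  refine rank_eq_one_of_not_isTorsion_of_coinvariantsRank_le_one p ?_ ?_
  · exact not_isTorsion_of_not_isTorsion_selmerDualData W κ hγ (selmerInfty_le_unramifiedOutside W κ S₀ hgood)
      (fun c hc ↦ conjH1_mem_unramifiedOutside κ.kerSubgroup (W.geomPrimaryTorsion p) p _ γ hc) dY hbij hT hC hNT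
  · rw [SSFlatEC.coinvariantsRank_eq_zpCorank_unramifiedOutside_top W κ hγ hS₀ dY hbij hT hC]
    exact hco

/-- **Over `ℚ` at a good supersingular prime: the door's `hrank` WITHOUT weak Leopoldt.** For `W/ℚ` globally minimal
elliptic with `GoodSS W p` (good reduction at `p`, `p ∣ a_p`), `κ` cyclotomic with topological generator `γ`, `Σ₀` finite with
good reduction off `Σ₀ ∪ {p}`, `Sel_{p^∞}(E/ℚ)` finite: every finitely generated dual datum `Y` of `H¹(ℚ_Σ/ℚ_∞, E[p^∞])` has
`rank_Λ Y = 1`, GIVEN the corank count `Greenberg1999.h1Sigma_zpCorank_le_degree ℚ` (pp. 119–120) and Greenberg's Thm. 1.7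
`SelmerDualData.not_isTorsion_of_supersingular` for the canonical datum (both PRINTED named facts; the second splits in the
tree as (I1) `relaxedSelmer_torsion_card_growth` + (I2) `CoatesGreenberg1996_H1_formalGroup_trivial`). The unit-root bridge is
`hasUnitRootAt_iff_not_dvd_frobeniusTrace`. [cite: GreenbergLNM1716, §1 Thm. 1.7 (pp. 61–62), §4 pp. 119–120] -/
theorem h1SigmaInfty_rank_eq_one_of_corank_of_notTorsion (W : WeierstrassCurve ℚ) [W.IsElliptic] [W.IsGloballyMinimal]
    (p : ℕ) [Fact p.Prime] (hss : Rank1Residual.GoodSS W p) (κ : ZpExtension ℚ p) (γ : Field.absoluteGaloisGroup ℚ)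
    (hκ : κ.IsCyclotomic) (hγ : κ.IsTopGenerator γ) (S₀ : Finset (HeightOneSpectrum (𝓞 ℚ)))
    (hgood : ∀ v : HeightOneSpectrum (𝓞 ℚ), v ∉ S₀ → ((p : ℕ) : 𝓞 ℚ) ∉ v.asIdeal → W.HasGoodReductionAt v)
    (hcork : Greenberg1999.h1Sigma_zpCorank_le_degree ℚ)
    (hNT : (W.selmerDualData κ hγ).not_isTorsion_of_supersingular)
    (hSel : Finite (W.selmerGroupPInfty p))
    (Y : Type) [AddCommGroup Y] [Module (IwasawaAlgebra p) Y] [Module.Finite (IwasawaAlgebra p) Y]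
    (dY : Y →+ (unramifiedOutside κ.kerSubgroup (W.geomPrimaryTorsion p) p
      (↑S₀ : Set (HeightOneSpectrum (𝓞 ℚ))) →+ AddCircle (1 : ℚ)))
    (hbij : Function.Bijective dY)
    (hT : ∀ (y : Y) (c : unramifiedOutside κ.kerSubgroup (W.geomPrimaryTorsion p) p
        (↑S₀ : Set (HeightOneSpectrum (𝓞 ℚ)))),
      dY ((PowerSeries.X : IwasawaAlgebra p) • y) c =
        dY y ⟨W.conjH1 p κ.kerSubgroup γ c,
          conjH1_mem_unramifiedOutside κ.kerSubgroup (W.geomPrimaryTorsion p) p _ γ c.2⟩ - dY y c)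
    (hC : ∀ (a : ℤ_[p]) (y : Y) (c : unramifiedOutside κ.kerSubgroup (W.geomPrimaryTorsion p) p
        (↑S₀ : Set (HeightOneSpectrum (𝓞 ℚ)))) (k : ℕ), (p ^ k) • c = 0 →
      dY (PowerSeries.C a • y) c = (PadicInt.toZModPow k a).val • dY y c) :
    Module.rank (IwasawaAlgebra p) Y = 1 := by
  have hp : p.Prime := Fact.out
  have hgood' : ∀ w : HeightOneSpectrum (𝓞 ℚ), w ∉ (↑S₀ : Set (HeightOneSpectrum (𝓞 ℚ))) →
      ((p : ℕ) : 𝓞 ℚ) ∉ w.asIdeal → W.HasGoodReductionAt w :=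
    fun w hw hpw ↦ hgood w (fun h ↦ hw (Finset.mem_coe.mpr h)) hpw
  -- the corank count `corank_{ℤ_p} H¹(ℚ_Σ/ℚ, E[p^∞]) ≤ [ℚ:ℚ] = 1`
  have hco : zpCorank ↥(unramifiedOutside (⊤ : Subgroup (Field.absoluteGaloisGroup ℚ)) (W.geomPrimaryTorsion p) p
      (↑S₀ : Set (HeightOneSpectrum (𝓞 ℚ)))) p ≤ 1 := by
    have h := hcork W p hSel (↑S₀ : Set (HeightOneSpectrum (𝓞 ℚ))) S₀.finite_toSet hgood'
    rwa [Module.finrank_self] at h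
  -- Thm. 1.7: the place of `ℚ` above `p` is good supersingular
  have hv : ∃ v : HeightOneSpectrum (𝓞 ℚ), (p : 𝓞 ℚ) ∈ v.asIdeal ∧ W.HasGoodReductionAt v ∧ ¬ W.HasUnitRootAt v := by
    refine ⟨(Rat.HeightOneSpectrum.primesEquiv (R := 𝓞 ℚ)).symm ⟨p, hp⟩, ?_, ?_, ?_⟩
    · exact (natCast_mem_asIdeal_iff_eq_primesEquiv_symm _ hp).mpr rfl
    · exact W.hasGoodReductionAt_of_hasGoodReductionAtPrime _
        ((natCast_mem_asIdeal_iff_eq_primesEquiv_symm _ hp).mpr rfl) hss.1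
    · rw [W.hasUnitRootAt_iff_not_dvd_frobeniusTrace _ hp ((natCast_mem_asIdeal_iff_eq_primesEquiv_symm _ hp).mpr rfl),
        not_not]
      exact hss.2
  have hNT' : ¬ (W.selmerDualData κ hγ).IsTorsion := hNT hκ hγ hv
  exact h1SigmaInfty_rank_eq_one_of_zpCorank_le_one_of_not_isTorsion W κ hγ S₀.finite_toSet hgood' dY hbij hT hC hco hNT'

end Rank

end Summit.BirchSwinnertonDyer.BirchSwinnertonDyer.Theorems.SignedEC.H1SigmaRank

end
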